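import Mathlib
import Summits.CriticalPhenomena.Ising3DConformalLimit.Theorems.PrecisionLaplacianMoebiusLimitOfTwoPointLawDensityOfLawReversal
import HarnessLib

/-!
# The weak dilation identity from the special-conformal Ward identity and translations
(stub W1 `stub_weakDilation` of line `multipole-ward-nonsat-endpoint`, crux
`MoebiusLimitOfTwoPointLaw`, item stmt-CriticalPhenomena-4801)

Pure analysis on `CorrFamily 3`, no probability. Let `S` be continuous on `NonCoincident`,
translation invariant, and satisfy the weak special-conformal Ward identities with weight `Δ`: for
every direction `b` and every smooth `φ` compactly supported in `NonCoincident 3 n`,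
`∫ S_n(x) [(2Δ−6)(Σᵢ⟪b,xᵢ⟫) φ(x) + Dφ(x)[(K_b(xᵢ))ᵢ]] dx = 0`, where `K_b(y) = ‖y‖² b − 2⟪b,y⟫ y`.
Then the weak DILATION identity `∫ S_n(x) [(3−Δ) n φ(x) + Dφ(x)[x]] dx = 0` holds
(`stub_weakDilation`). This is the Lie-algebra relation `[P_b, K_b] = −2 D` (`‖b‖ = 1`), realised
without second derivatives: test the `K`-identity with the diagonal translate `φ(· − t b̂)`,
`b̂ = (b, …, b)` (again admissible, `testFunction_translate`), substitute `x = y + t b̂`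
(`integral_add_right_eq_self`, `S(y + t b̂) = S(y)`) and expand
`K_b(yᵢ + t b) = K_b(yᵢ) − 2t yᵢ − t² b`, `⟪b, yᵢ + t b⟫ = ⟪b, yᵢ⟫ + t` (`sctField_add_smul`,
`ward_integrand_translate`): the result is a polynomial identity `A + t B − t² C = 0` for all real
`t`, whence `B = ∫ S_n [(2Δ−6) n φ − 2 Dφ[y]] = 0`, which is `−2` times the claim.

References: Di Francesco–Mathieu–Sénéchal, *Conformal Field Theory* (1997) §4.3.1 (dilations and
special conformal transformations, (4.62)) [FrancescoMathieuSenechal1997].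
-/

noncomputable section

namespace Summit.CriticalPhenomena.Ising3DConformalLimit.PrecisionLaplacianMoebiusLimitOfTwoPointLaw

open Literature.Probability.LatticeModels Filter Topology MeasureTheory

/-! ## Auxiliary lemmas -/

/-- A continuous function `ψ` vanishing off `tsupport φ`, where `φ` is compactly supported inside
an open set `V` on which `g` is continuous, has an integrable product with `g`. -/
theorem integrable_mul_of_eq_zero_off_tsupport {X : Type*} [MeasurableSpace X]
    [TopologicalSpace X] [OpensMeasurableSpace X] {μ : Measure X} [IsFiniteMeasureOnCompacts μ]
    {g φ ψ : X → ℝ} {V : Set X} (hg : ContinuousOn g V) (hV : IsOpen V)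
    (hφc : HasCompactSupport φ) (hφV : tsupport φ ⊆ V) (hψ : Continuous ψ)
    (hψ0 : ∀ x, x ∉ tsupport φ → ψ x = 0) :
    Integrable (fun x => g x * ψ x) μ := by
  have hsupp : Function.support ψ ⊆ tsupport φ := fun x hx => by_contra fun h => hx (hψ0 x h)
  exact integrable_mul_of_continuousOn hg hV hψ (hφc.mono' hsupp)
    ((closure_minimal hsupp (isClosed_tsupport φ)).trans hφV)

/-- The special conformal vector field `K_b(y) = ‖y‖² b − 2⟪b,y⟫ y` along a unit direction `b`,
shifted by `t b`: `K_b(y + t b) = K_b(y) − 2t y − t² b`. -/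
theorem sctField_add_smul {b : EuclideanSpace ℝ (Fin 3)} (hb : ‖b‖ = 1) (t : ℝ)
    (y : EuclideanSpace ℝ (Fin 3)) :
    ‖y + t • b‖ ^ 2 • b - (2 * inner ℝ b (y + t • b)) • (y + t • b) =
      (‖y‖ ^ 2 • b - (2 * inner ℝ b y) • y) - (2 * t) • y - t ^ 2 • b := by
  have h1 : ‖y + t • b‖ ^ 2 = ‖y‖ ^ 2 + 2 * t * inner ℝ b y + t ^ 2 := by
    rw [norm_add_sq_real, real_inner_smul_right, real_inner_comm b y, norm_smul, mul_pow, hb,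
      Real.norm_eq_abs, sq_abs]
    ring
  have h2 : inner ℝ b (y + t • b) = inner ℝ b y + t := by
    rw [inner_add_right, real_inner_smul_right, real_inner_self_eq_norm_sq, hb]
    ring
  rw [h1, h2]
  module

/-- Translating a smooth test function compactly supported in `NonCoincident 3 n` along a diagonal
direction `v̂ = (v, …, v)` gives again such a test function (the diagonal translation preserves
injectivity of configurations). -/
theorem testFunction_translate {n : ℕ} {φ : (Fin n → EuclideanSpace ℝ (Fin 3)) → ℝ}
    (hφ : ContDiff ℝ ((⊤ : ℕ∞) : WithTop ℕ∞) φ) (hφc : HasCompactSupport φ)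
    (hφV : tsupport φ ⊆ NonCoincident 3 n) (v : EuclideanSpace ℝ (Fin 3)) :
    ContDiff ℝ ((⊤ : ℕ∞) : WithTop ℕ∞) (fun x => φ (x - fun _ => v)) ∧
      HasCompactSupport (fun x => φ (x - fun _ => v)) ∧
      tsupport (fun x => φ (x - fun _ => v)) ⊆ NonCoincident 3 n := by
  refine ⟨hφ.comp (contDiff_id.sub contDiff_const),
    hφc.comp_homeomorph (Homeomorph.subRight fun _ : Fin n => v), fun x hx => ?_⟩
  have hx' : (x - fun _ => v) ∈ tsupport φ :=
    tsupport_comp_subset_preimage φ (f := fun x => x - fun _ => v) (by fun_prop) hx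
  have hinj : Function.Injective (x - fun _ => v) := hφV hx'
  exact (mem_nonCoincident x).2 fun i j hij => hinj (by simp only [Pi.sub_apply, hij])

/-- The `K`-Ward integrand of the translated test function `φ(· − t b̂)`, pulled back along
`x = y + t b̂` and using `S(y + t b̂) = S(y)`, is the quadratic polynomial `A(y) + t B(y) − t² C(y)`
in `t`. -/
theorem ward_integrand_translate (S : CorrFamily 3) (Δ : ℝ) (htr : IsTranslationInvariant S)
    {n : ℕ} (φ : (Fin n → EuclideanSpace ℝ (Fin 3)) → ℝ) {b : EuclideanSpace ℝ (Fin 3)}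
    (hb : ‖b‖ = 1) (t : ℝ) (y : Fin n → EuclideanSpace ℝ (Fin 3)) :
    S n y * ((2 * Δ - 6) * (∑ i, inner ℝ b (y i)) * φ y +
          fderiv ℝ φ y (fun i => ‖y i‖ ^ 2 • b - (2 * inner ℝ b (y i)) • y i)) +
        t * (S n y * ((2 * Δ - 6) * n * φ y - 2 * fderiv ℝ φ y y)) -
        t ^ 2 * (S n y * fderiv ℝ φ y (fun _ => b)) =
      (fun x : Fin n → EuclideanSpace ℝ (Fin 3) =>
        S n x * ((2 * Δ - 6) * (∑ i, inner ℝ b (x i)) * φ (x - fun _ => t • b) +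
          fderiv ℝ (fun z => φ (z - fun _ => t • b)) x
            (fun i => ‖x i‖ ^ 2 • b - (2 * inner ℝ b (x i)) • x i))) (y + fun _ => t • b) := by
  beta_reduce
  have hS : S n (y + fun _ => t • b) = S n y := htr n (t • b) y
  have hφ : φ ((y + fun _ => t • b) - fun _ => t • b) = φ y := by rw [add_sub_cancel_right]
  have hD : fderiv ℝ (fun z => φ (z - fun _ => t • b)) (y + fun _ => t • b) = fderiv ℝ φ y := by
    rw [fderiv_comp_sub, add_sub_cancel_right]
  have hsum : ∑ i, inner ℝ b (((y + fun _ => t • b) : Fin n → EuclideanSpace ℝ (Fin 3)) i) =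
      ∑ i, inner ℝ b (y i) + n * t := by
    simp only [Pi.add_apply, inner_add_right, real_inner_smul_right, real_inner_self_eq_norm_sq,
      hb, one_pow, mul_one, Finset.sum_add_distrib, Finset.sum_const, Finset.card_univ,
      Fintype.card_fin, nsmul_eq_mul]
  have hK : (fun i => ‖((y + fun _ => t • b) : Fin n → EuclideanSpace ℝ (Fin 3)) i‖ ^ 2 • b -
        (2 * inner ℝ b (((y + fun _ => t • b) : Fin n → EuclideanSpace ℝ (Fin 3)) i)) •
          ((y + fun _ => t • b) : Fin n → EuclideanSpace ℝ (Fin 3)) i) =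
      (fun i => ‖y i‖ ^ 2 • b - (2 * inner ℝ b (y i)) • y i) - (2 * t) • y -
        t ^ 2 • fun _ => b := by
    funext i
    simp only [Pi.add_apply, Pi.sub_apply, Pi.smul_apply]
    exact sctField_add_smul hb t (y i)
  rw [hS, hφ, hD, hsum, hK]
  simp only [map_sub, map_smul, smul_eq_mul]
  ring

/-- Integrated form of `ward_integrand_translate`: with `A = ∫ S [(2Δ−6)(Σ⟪b,yᵢ⟫) φ + Dφ[K⃗]]`,
`B = ∫ S [(2Δ−6) n φ − 2 Dφ[y]]`, `C = ∫ S Dφ[b̂]`, the `K`-Ward integral of the translate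
`φ(· − t b̂)` equals `∫ (A(y) + t B(y) − t² C(y)) dy` (`integral_add_right_eq_self`). -/
theorem ward_integral_translate (S : CorrFamily 3) (Δ : ℝ) (htr : IsTranslationInvariant S)
    {n : ℕ} (φ : (Fin n → EuclideanSpace ℝ (Fin 3)) → ℝ) {b : EuclideanSpace ℝ (Fin 3)}
    (hb : ‖b‖ = 1) (t : ℝ) :
    ∫ y : Fin n → EuclideanSpace ℝ (Fin 3),
        (S n y * ((2 * Δ - 6) * (∑ i, inner ℝ b (y i)) * φ y +
            fderiv ℝ φ y (fun i => ‖y i‖ ^ 2 • b - (2 * inner ℝ b (y i)) • y i)) +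
          t * (S n y * ((2 * Δ - 6) * n * φ y - 2 * fderiv ℝ φ y y)) -
          t ^ 2 * (S n y * fderiv ℝ φ y (fun _ => b))) =
      ∫ x : Fin n → EuclideanSpace ℝ (Fin 3),
        S n x * ((2 * Δ - 6) * (∑ i, inner ℝ b (x i)) * φ (x - fun _ => t • b) +
          fderiv ℝ (fun z => φ (z - fun _ => t • b)) x
            (fun i => ‖x i‖ ^ 2 • b - (2 * inner ℝ b (x i)) • x i)) := by
  refine Eq.trans ?_ (integral_add_right_eq_self _ (fun _ : Fin n => t • b))
  exact integral_congr_ae (Eventually.of_forall fun y => ward_integrand_translate S Δ htr φ hb t y)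

/-! ## The stub -/

/-- **Stub W1 — weak dilation identity from K-Ward + translations.** For `S : CorrFamily 3`,
continuous on `NonCoincident` and translation invariant, the weak special-conformal Ward identities
with weight `Δ` imply the weak DILATION identity `∫ S_n(x) [(3 − Δ) n φ(x) + Dφ(x)[x]] dx = 0` for
every smooth `φ` compactly supported in `NonCoincident 3 n`. Proof: apply the K-identity (unit
direction `b`) to `φ_t := φ(· − t b̂)`, substitute `x = y + t b̂` and expand: a polynomial identity
`A + tB − t²C = 0` for all `t`, with `A = 0` (the K-identity for `φ` itself), so
`B = ∫ S [(2Δ−6) n φ − 2 Dφ[y]] = 0`, which is `−2` times the claim.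
[FrancescoMathieuSenechal1997 §4.3.1] -/
theorem stub_weakDilation :
    ∀ (S : CorrFamily 3) (Δ : ℝ), (∀ n, ContinuousOn (S n) (NonCoincident 3 n)) →
      IsTranslationInvariant S →
      (∀ (n : ℕ) (b : EuclideanSpace ℝ (Fin 3)) (φ : (Fin n → EuclideanSpace ℝ (Fin 3)) → ℝ),
        ContDiff ℝ ((⊤ : ℕ∞) : WithTop ℕ∞) φ → HasCompactSupport φ →
        tsupport φ ⊆ NonCoincident 3 n →
        ∫ x, S n x * ((2 * Δ - 6) * (∑ i, inner ℝ b (x i)) * φ x +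
          fderiv ℝ φ x (fun i => ‖x i‖ ^ 2 • b - (2 * inner ℝ b (x i)) • x i)) = 0) →
      ∀ (n : ℕ) (φ : (Fin n → EuclideanSpace ℝ (Fin 3)) → ℝ),
        ContDiff ℝ ((⊤ : ℕ∞) : WithTop ℕ∞) φ → HasCompactSupport φ →
        tsupport φ ⊆ NonCoincident 3 n →
        ∫ x, S n x * (((3 : ℝ) - Δ) * n * φ x + fderiv ℝ φ x x) = 0 := by
  intro S Δ hcont htr hward n φ hφ hφc hφV
  obtain ⟨b, hb⟩ : ∃ b : EuclideanSpace ℝ (Fin 3), ‖b‖ = 1 := ⟨EuclideanSpace.single 0 1, by simp⟩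
  have hφ0 : Continuous φ := hφ.continuous
  have hD0 : Continuous (fderiv ℝ φ) := hφ.continuous_fderiv (by simp)
  have hV := isOpen_nonCoincident 3 n
  -- integrability of the three coefficients `A`, `B`, `C` of the polynomial identity
  have hIA : Integrable (fun y : Fin n → EuclideanSpace ℝ (Fin 3) =>
      S n y * ((2 * Δ - 6) * (∑ i, inner ℝ b (y i)) * φ y +
        fderiv ℝ φ y (fun i => ‖y i‖ ^ 2 • b - (2 * inner ℝ b (y i)) • y i))) := by
    refine integrable_mul_of_eq_zero_off_tsupport (hcont n) hV hφc hφV ?_ fun y hy => ?_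
    · exact (by fun_prop : Continuous fun y : Fin n → EuclideanSpace ℝ (Fin 3) =>
          (2 * Δ - 6) * (∑ i, inner ℝ b (y i)) * φ y).add (hD0.clm_apply (by fun_prop))
    · simp [image_eq_zero_of_notMem_tsupport hy, fderiv_of_notMem_tsupport ℝ hy]
  have hIB : Integrable (fun y : Fin n → EuclideanSpace ℝ (Fin 3) =>
      S n y * ((2 * Δ - 6) * n * φ y - 2 * fderiv ℝ φ y y)) := by
    refine integrable_mul_of_eq_zero_off_tsupport (hcont n) hV hφc hφV ?_ fun y hy => ?_
    · exact (by fun_prop : Continuous fun y : Fin n → EuclideanSpace ℝ (Fin 3) =>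
          (2 * Δ - 6) * n * φ y).sub (continuous_const.mul (hD0.clm_apply continuous_id))
    · simp [image_eq_zero_of_notMem_tsupport hy, fderiv_of_notMem_tsupport ℝ hy]
  have hIC : Integrable (fun y : Fin n → EuclideanSpace ℝ (Fin 3) =>
      S n y * fderiv ℝ φ y (fun _ => b)) := by
    refine integrable_mul_of_eq_zero_off_tsupport (hcont n) hV hφc hφV
      (hD0.clm_apply continuous_const) fun y hy => ?_
    simp [fderiv_of_notMem_tsupport ℝ hy]
  -- `A = 0`: the K-identity for `φ` itself
  have hA : ∫ y : Fin n → EuclideanSpace ℝ (Fin 3),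
      S n y * ((2 * Δ - 6) * (∑ i, inner ℝ b (y i)) * φ y +
        fderiv ℝ φ y (fun i => ‖y i‖ ^ 2 • b - (2 * inner ℝ b (y i)) • y i)) = 0 :=
    hward n b φ hφ hφc hφV
  -- the polynomial identity `t B − t² C = 0` for all real `t`
  have hpoly : ∀ t : ℝ,
      t * (∫ y : Fin n → EuclideanSpace ℝ (Fin 3),
          S n y * ((2 * Δ - 6) * n * φ y - 2 * fderiv ℝ φ y y)) -
        t ^ 2 * (∫ y : Fin n → EuclideanSpace ℝ (Fin 3), S n y * fderiv ℝ φ y (fun _ => b)) =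
      0 := by
    intro t
    obtain ⟨h1, h2, h3⟩ := testFunction_translate hφ hφc hφV (t • b)
    have hW := hward n b (fun x => φ (x - fun _ => t • b)) h1 h2 h3
    have hW' := (ward_integral_translate S Δ htr φ hb t).trans hW
    rw [integral_sub (hIA.fun_add (hIB.const_mul t)) (hIC.const_mul (t ^ 2)),
      integral_add hIA (hIB.const_mul t), integral_const_mul, integral_const_mul, hA,
      zero_add] at hW'
    exact hW'
  -- `B = 0` from `t = ±1`, and `B` is `−2` times the claimed integral
  have hB : ∫ y : Fin n → EuclideanSpace ℝ (Fin 3),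
      S n y * ((2 * Δ - 6) * n * φ y - 2 * fderiv ℝ φ y y) = 0 := by
    have h1 := hpoly 1
    have h2 := hpoly (-1)
    linear_combination (h1 - h2) / 2
  have hrel : ∫ y : Fin n → EuclideanSpace ℝ (Fin 3),
        S n y * ((2 * Δ - 6) * n * φ y - 2 * fderiv ℝ φ y y) =
      -2 * ∫ x : Fin n → EuclideanSpace ℝ (Fin 3),
        S n x * (((3 : ℝ) - Δ) * n * φ x + fderiv ℝ φ x x) := by
    rw [← integral_const_mul]
    refine integral_congr_ae (Eventually.of_forall fun y => ?_)
    ring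
  linarith [hB, hrel]

end Summit.CriticalPhenomena.Ising3DConformalLimit.PrecisionLaplacianMoebiusLimitOfTwoPointLaw
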